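/-
Copyright (c) 2026 the pub-hodgecm-mathlib formalisation cell (harness21).  Prover seat hodgecm-mathlib-F0P2-p10 (g4), Track B ∕ R90-TF, h413 = `stmt-HodgeConjecture-24833`,
R90-TF section S8 «ContSpec-n½», socket (E) :276, E1-PLANCHEREL BODY, letter `hFub` piece (b) (S8 dealer R90-CS-plan (g4) S8-R285; joint census `R90/S8/CENSUS-PlancherelBody-bricks.K2E1-p16-F0P2-p10.md` §PB-1):
THE FUBINI SWAP `N(𝔸) × {Re w = c₀ > 2}` in the Godement range — `CT θ_{f,ψ}(g) − f(Hg)ψ(g) = (ν𝓕)⁻¹•(2π)⁻¹∫_ℝ mellin f(−w)·(∫_{N(𝔸)} f_w^ψ(w₀vg) dν(v)) dy`, `w = c₀ + iy`, `f ∈ C²_c((0,∞))`,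
the inner integral being the intertwining integral of the flat section `f_w^ψ = ψ·H^w` (★ `flatSectionU_intertwinedCoeff_three_eq`'s currency for piece (c)).
-/
import Summits.HodgeConjecture.HodgeConjecture.Theorems.K2E1ChiOrbitalIntegralMellinInsideCMThree   -- ★ hFub-a p865351: `borelConstantTerm_sub_eq_orbital_mellin_inside_cm_three` (brings ★ C2, ★ A)
import Summits.HodgeConjecture.HodgeConjecture.Theorems.K2E1ChiUnfoldingTonelliLetterU3              -- ★ (K2E1-p14): `integrable_flatSectionU_weylLongU_mul_of_continuous_bounded` (global `L¹` on `N(𝔸)`, `Re z > 2`)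
import Summits.HodgeConjecture.HodgeConjecture.Theorems.K2E1HeisenbergHaarU3                        -- ★ `locallyCompactSpace_and_secondCountableTopology_adelicUnipotent` (⇒ `SigmaFinite ν`)
import Literature.NumberTheory.Automorphic.UnitaryGroupBorelHeightContinuous                          -- ★ `continuous_borelHeight`
import HarnessLib

/-!
# hFub-b — `K2E1ChiOrbitalIntegralFubiniCMThree`: THE FUBINI SWAP `N(𝔸) × {Re w = c₀ > 2}` FOR THE INTERTWINED PART OF THE CONSTANT TERM ON `U(2,1)`

Track B ∕ R90-TF, crux h413 = `stmt-HodgeConjecture-24833`, route of record `HCCMUnconditional`; cell `hodgecm-mathlib`, R90-TF programme, section S8 «ContSpec-n½», socket (E)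
(B ED. 7 :276), E1-PLANCHEREL BODY.  MW's two-term inner-product formula II.2.1 for `θ_{f,φ}` on `U(2,1)_{L∕L⁺}` is ★ modulo the named letter `hFub` (★ PB-1a p865168, PB-1b
p865195 + p865252, PB-1c-0 p865290, PB-1c-1 p865336), cut into (a) ★ p865351 Mellin inversion inside ★ C2's orbital integral, (b) THIS FILE, (c) the `G`-unfolding with the
reflected-pair dichotomy (analytic hand).  THEOREMS ONLY (no `def`, no `instance`, no notation, no named-fact hypothesis, no `sorry`; default heartbeats);
lane `--supports stmt-HodgeConjecture-24833 --as helper` (count-neutral).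

THE MATHEMATICS ([MoeglinWaldspurger1995] II.1.5, II.1.7).  After ★ hFub-a, `CT θ_{f,ψ}(g) − f(Hg)ψ(g) = (ν𝓕)⁻¹•∫_{N(𝔸)} ((2π)⁻¹∫_ℝ H(w₀vg)^{c₀+iy}·mellin f(−(c₀+iy)) dy)·ψ(w₀vg) dν(v)`.
Put `Φ(v,y) := H(w₀vg)^{c₀+iy}·mellin f(−(c₀+iy))·ψ(w₀vg)`.  Then `Φ` is CONTINUOUS on `N(𝔸) × ℝ` (★ `continuous_borelHeight`, ★ A `continuousOn_cpow_two`, ★ A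
`differentiable_mellin`), and **`‖Φ(v,y)‖ = ‖f_{c₀}^ψ(w₀vg)‖·‖mellin f(−(c₀+iy))‖` EXACTLY** (`|H^{iy}| = 1`, ★ `norm_flatSectionU`) — the product of an `L¹(ν)` function
(★ K2E1-p14 `integrable_flatSectionU_weylLongU_mul_of_continuous_bounded`, the Godement range `c₀ > 2`) and an `L¹(dy)` function (★ A `verticalIntegrable_mellin`, `f ∈ C²_c((0,∞))`),
so `Φ ∈ L¹(ν ⊗ dy)` (Mathlib `Integrable.mul_prod` + `Integrable.mono'`) and `MeasureTheory.integral_integral_swap` applies (`ν` is σ-finite: `N(𝔸)` is locally compact second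
countable, ★ `K2E1HeisenbergHaarU3`).  Reading `Φ(v,y) = mellin f(−w)·f_w^ψ(w₀vg)` (`f_w^ψ = ψ·H^w`, ★ `flatSectionU`) gives the HEAD
**`CT θ_{f,ψ}(g) − f(Hg)ψ(g) = (ν𝓕)⁻¹•((2π)⁻¹∫_ℝ mellin f(−(c₀+iy))·(∫_{N(𝔸)} f_{c₀+iy}^ψ(w₀vg) dν(v)) dy)`**; the inner integral is the left side of ★
`K2E1ChiIntertwinedSectionU3.flatSectionU_intertwinedCoeff_three_eq` (`= (M(w₀,w)ψ)(g)·H(g)^{2−w}` currency), the input of piece (c).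
TECHNICAL: ★ K2E1-p14's lemma carries a Borel structure on `𝔸_L` in its context, hence the binders `[MeasurableSpace (AdeleRing (𝓞 L) L)] [BorelSpace (AdeleRing (𝓞 L) L)]` below.

HONEST LABEL.  Piece (b) of one named letter; pays nothing at the (E) socket.  HC_CM is proved only modulo the 7 printed citations (2 remaining named inputs: hLiu418 =
`stmt-HodgeConjecture-24832`, h413 = `stmt-HodgeConjecture-24833`) until rung 0 closes; count-neutral.
-/

set_option autoImplicit false
set_option linter.dupNamespace false  -- the mandated namespace repeats the summit's segment (`HodgeConjecture.HodgeConjecture`)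

noncomputable section

open MeasureTheory Measure Set Filter Topology Complex NumberField IsDedekindDomain MulAction Function
open scoped Real NNReal ENNReal ComplexConjugate
open Literature.MeasureTheory.Group Literature.NumberTheory
open Literature.NumberTheory.Automorphic Literature.NumberTheory.Automorphic.UnitaryGroup AdelicGroupData
open Literature.NumberTheory.GaloisRepresentations (HeckeCharacter ideleGroup)
open Summit.HodgeConjecture.HodgeConjecture.Cruxes.H413.K2E1BorelEisensteinU
open Summit.HodgeConjecture.HodgeConjecture.Cruxes.H413.K2E1MellinPaleyWienerHalfLine (differentiable_mellin verticalIntegrable_mellin continuousOn_cpow_two)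
open Summit.HodgeConjecture.HodgeConjecture.Cruxes.H413.K2E1ChiOrbitalIntegralMellinInsideCMThree (borelConstantTerm_sub_eq_orbital_mellin_inside_cm_three)
open Summit.HodgeConjecture.HodgeConjecture.Cruxes.H413.K2E1ChiUnfoldingTonelliLetterU3 (integrable_flatSectionU_weylLongU_mul_of_continuous_bounded)
open Summit.HodgeConjecture.HodgeConjecture.Cruxes.H413.K2E1HeisenbergHaarU3 (locallyCompactSpace_and_secondCountableTopology_adelicUnipotent)

namespace Summit.HodgeConjecture.HodgeConjecture.Cruxes.H413.K2E1ChiOrbitalIntegralFubiniCMThree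

variable (L : Type) [Field L] [NumberField L] [IsCMField L]
variable [MeasurableSpace (quasiSplit (↥(maximalRealSubfield L)) L (IsCMField.complexConj L) 3).Adelic] [BorelSpace (quasiSplit (↥(maximalRealSubfield L)) L (IsCMField.complexConj L) 3).Adelic]

/-! ## §1 The two-variable integrand `Φ(v,y) = H(w₀vg)^{c₀+iy}·mellin f(−(c₀+iy))·ψ(w₀vg)`: continuity, exact norm, product integrability, swap -/

omit [MeasurableSpace (quasiSplit (↥(maximalRealSubfield L)) L (IsCMField.complexConj L) 3).Adelic] [BorelSpace (quasiSplit (↥(maximalRealSubfield L)) L (IsCMField.complexConj L) 3).Adelic] in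
/-- **`Φ` is continuous on `N(𝔸) × ℝ`**: `v ↦ w₀vg` and `H` are continuous (★ `continuous_borelHeight`), `(r,y) ↦ r^{c₀+iy}` is continuous on `(0,∞) × ℝ` (★ A `continuousOn_cpow_two`,
`H > 0`), `y ↦ mellin f(−(c₀+iy))` is continuous (★ A `differentiable_mellin`), `ψ` is continuous. [cite: MoeglinWaldspurger1995, II.1.5] -/
theorem continuous_orbitalMellinIntegrand_cm_three {f : ℝ → ℂ} (hf : ContDiff ℝ 2 f) (hfs : HasCompactSupport f) (hf0 : tsupport f ⊆ Ioi 0)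
    {ψ : (quasiSplit (↥(maximalRealSubfield L)) L (IsCMField.complexConj L) 3).Adelic → ℂ} (hψc : Continuous ψ) (c₀ : ℝ)
    (g : (quasiSplit (↥(maximalRealSubfield L)) L (IsCMField.complexConj L) 3).Adelic) :
    Continuous fun p : ↥(adelicUnipotent (↥(maximalRealSubfield L)) L (IsCMField.complexConj L) 3) × ℝ =>
      ((borelHeight ((quasiSplit (↥(maximalRealSubfield L)) L (IsCMField.complexConj L) 3).toAdelic (weylLongU ((IsCMField.complexConj L : L ≃ₐ[↥(maximalRealSubfield L)] L) : L →+* L) (rfl : (StdForm.antidiagonal 3).over L = (StdForm.antidiagonal 3).over L)) *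
          (p.1 : (quasiSplit (↥(maximalRealSubfield L)) L (IsCMField.complexConj L) 3).Adelic) * g) : ℝ) : ℂ) ^ ((c₀ : ℂ) + p.2 * I) *
        mellin f (-((c₀ : ℂ) + p.2 * I)) *
      ψ ((quasiSplit (↥(maximalRealSubfield L)) L (IsCMField.complexConj L) 3).toAdelic (weylLongU ((IsCMField.complexConj L : L ≃ₐ[↥(maximalRealSubfield L)] L) : L →+* L) (rfl : (StdForm.antidiagonal 3).over L = (StdForm.antidiagonal 3).over L)) *
          (p.1 : (quasiSplit (↥(maximalRealSubfield L)) L (IsCMField.complexConj L) 3).Adelic) * g) := by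
  have hW : Continuous fun v : ↥(adelicUnipotent (↥(maximalRealSubfield L)) L (IsCMField.complexConj L) 3) =>
      (quasiSplit (↥(maximalRealSubfield L)) L (IsCMField.complexConj L) 3).toAdelic (weylLongU ((IsCMField.complexConj L : L ≃ₐ[↥(maximalRealSubfield L)] L) : L →+* L) (rfl : (StdForm.antidiagonal 3).over L = (StdForm.antidiagonal 3).over L)) *
        (v : (quasiSplit (↥(maximalRealSubfield L)) L (IsCMField.complexConj L) 3).Adelic) * g :=
    (continuous_const.mul continuous_subtype_val).mul continuous_const
  have hH : Continuous fun v : ↥(adelicUnipotent (↥(maximalRealSubfield L)) L (IsCMField.complexConj L) 3) =>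
      (borelHeight ((quasiSplit (↥(maximalRealSubfield L)) L (IsCMField.complexConj L) 3).toAdelic (weylLongU ((IsCMField.complexConj L : L ≃ₐ[↥(maximalRealSubfield L)] L) : L →+* L) (rfl : (StdForm.antidiagonal 3).over L = (StdForm.antidiagonal 3).over L)) *
        (v : (quasiSplit (↥(maximalRealSubfield L)) L (IsCMField.complexConj L) 3).Adelic) * g) : ℝ) :=
    NNReal.continuous_coe.comp (continuous_borelHeight.comp hW)
  have hpair : Continuous fun p : ↥(adelicUnipotent (↥(maximalRealSubfield L)) L (IsCMField.complexConj L) 3) × ℝ =>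
      ((borelHeight ((quasiSplit (↥(maximalRealSubfield L)) L (IsCMField.complexConj L) 3).toAdelic (weylLongU ((IsCMField.complexConj L : L ≃ₐ[↥(maximalRealSubfield L)] L) : L →+* L) (rfl : (StdForm.antidiagonal 3).over L = (StdForm.antidiagonal 3).over L)) *
        (p.1 : (quasiSplit (↥(maximalRealSubfield L)) L (IsCMField.complexConj L) 3).Adelic) * g) : ℝ), p.2) :=
    (hH.comp continuous_fst).prodMk continuous_snd
  have hcpow : Continuous fun p : ↥(adelicUnipotent (↥(maximalRealSubfield L)) L (IsCMField.complexConj L) 3) × ℝ =>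
      ((borelHeight ((quasiSplit (↥(maximalRealSubfield L)) L (IsCMField.complexConj L) 3).toAdelic (weylLongU ((IsCMField.complexConj L : L ≃ₐ[↥(maximalRealSubfield L)] L) : L →+* L) (rfl : (StdForm.antidiagonal 3).over L = (StdForm.antidiagonal 3).over L)) *
          (p.1 : (quasiSplit (↥(maximalRealSubfield L)) L (IsCMField.complexConj L) 3).Adelic) * g) : ℝ) : ℂ) ^ ((c₀ : ℂ) + p.2 * I) :=
    (continuousOn_cpow_two c₀).comp_continuous hpair fun p => ⟨by exact_mod_cast borelHeight_pos _, mem_univ _⟩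
  have hM : Continuous fun p : ↥(adelicUnipotent (↥(maximalRealSubfield L)) L (IsCMField.complexConj L) 3) × ℝ => mellin f (-((c₀ : ℂ) + p.2 * I)) :=
    (differentiable_mellin hf.continuous hfs hf0).continuous.comp (by fun_prop)
  exact (hcpow.mul hM).mul (hψc.comp (hW.comp continuous_fst))

/-- **`Φ ∈ L¹(ν ⊗ dy)` in the Godement range**: for `ν` a Haar measure on `N(𝔸_{L⁺})`, `f ∈ C²_c((0,∞))`, `ψ` continuous bounded, `c₀ > 2` and any `g`, the integrand `Φ(v,y)` is integrable
on `ν.prod volume` — `‖Φ(v,y)‖ = ‖f_{c₀}^ψ(w₀vg)‖·‖mellin f(−(c₀+iy))‖` exactly (★ `norm_flatSectionU`, `|H^{iy}| = 1`), a product of ★ K2E1-p14's `L¹(ν)` function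
(`integrable_flatSectionU_weylLongU_mul_of_continuous_bounded`, `Re = c₀ > 2`) and ★ A's `L¹(dy)` function (`verticalIntegrable_mellin`) (Mathlib `Integrable.mul_prod`, `Integrable.mono'`).
[cite: MoeglinWaldspurger1995, II.1.5] -/
theorem integrable_orbitalMellinIntegrand_prod_cm_three [MeasurableSpace (AdeleRing (𝓞 L) L)] [BorelSpace (AdeleRing (𝓞 L) L)]
    (ν : Measure ↥(adelicUnipotent (↥(maximalRealSubfield L)) L (IsCMField.complexConj L) 3)) [ν.IsHaarMeasure]
    {f : ℝ → ℂ} (hf : ContDiff ℝ 2 f) (hfs : HasCompactSupport f) (hf0 : tsupport f ⊆ Ioi 0)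
    {ψ : (quasiSplit (↥(maximalRealSubfield L)) L (IsCMField.complexConj L) 3).Adelic → ℂ} (hψc : Continuous ψ) {M : ℝ} (hψM : ∀ x, ‖ψ x‖ ≤ M) {c₀ : ℝ} (hc₀ : 2 < c₀)
    (g : (quasiSplit (↥(maximalRealSubfield L)) L (IsCMField.complexConj L) 3).Adelic) :
    Integrable (uncurry fun (v : ↥(adelicUnipotent (↥(maximalRealSubfield L)) L (IsCMField.complexConj L) 3)) (y : ℝ) =>
      ((borelHeight ((quasiSplit (↥(maximalRealSubfield L)) L (IsCMField.complexConj L) 3).toAdelic (weylLongU ((IsCMField.complexConj L : L ≃ₐ[↥(maximalRealSubfield L)] L) : L →+* L) (rfl : (StdForm.antidiagonal 3).over L = (StdForm.antidiagonal 3).over L)) *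
          (v : (quasiSplit (↥(maximalRealSubfield L)) L (IsCMField.complexConj L) 3).Adelic) * g) : ℝ) : ℂ) ^ ((c₀ : ℂ) + y * I) *
        mellin f (-((c₀ : ℂ) + y * I)) *
      ψ ((quasiSplit (↥(maximalRealSubfield L)) L (IsCMField.complexConj L) 3).toAdelic (weylLongU ((IsCMField.complexConj L : L ≃ₐ[↥(maximalRealSubfield L)] L) : L →+* L) (rfl : (StdForm.antidiagonal 3).over L = (StdForm.antidiagonal 3).over L)) *
          (v : (quasiSplit (↥(maximalRealSubfield L)) L (IsCMField.complexConj L) 3).Adelic) * g)) (ν.prod volume) := by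
  have hc : IsCMField.complexConj L * IsCMField.complexConj L = 1 := AlgEquiv.ext fun x => IsCMField.complexConj_apply_apply L x
  have hz : 2 < ((c₀ : ℂ)).re := by rwa [ofReal_re]
  -- the two one-variable `L¹` functions
  have hA : Integrable (fun v : ↥(adelicUnipotent (↥(maximalRealSubfield L)) L (IsCMField.complexConj L) 3) =>
      ‖flatSectionU ψ (c₀ : ℂ) ((quasiSplit (↥(maximalRealSubfield L)) L (IsCMField.complexConj L) 3).toAdelic (weylLongU ((IsCMField.complexConj L : L ≃ₐ[↥(maximalRealSubfield L)] L) : L →+* L) (rfl : (StdForm.antidiagonal 3).over L = (StdForm.antidiagonal 3).over L)) *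
        (v : (quasiSplit (↥(maximalRealSubfield L)) L (IsCMField.complexConj L) 3).Adelic) * g)‖) ν :=
    (integrable_flatSectionU_weylLongU_mul_of_continuous_bounded L hc ν hψc hψM hz g).norm.congr (Eventually.of_forall fun v => by simp only [mul_assoc])
  have hB : Integrable (fun y : ℝ => ‖mellin f (-((c₀ : ℂ) + y * I))‖) := by
    have h := (verticalIntegrable_mellin hf hfs hf0 (-c₀)).comp_neg
    refine (h.congr (Eventually.of_forall fun y => ?_)).norm
    simp only [ofReal_neg]; congr 1; ring
  refine (hA.mul_prod hB).mono' (continuous_orbitalMellinIntegrand_cm_three L hf hfs hf0 hψc c₀ g).aestronglyMeasurable (Eventually.of_forall fun p => le_of_eq ?_)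
  -- the exact norm identity
  obtain ⟨v, y⟩ := p
  have hHpos : 0 < (borelHeight ((quasiSplit (↥(maximalRealSubfield L)) L (IsCMField.complexConj L) 3).toAdelic (weylLongU ((IsCMField.complexConj L : L ≃ₐ[↥(maximalRealSubfield L)] L) : L →+* L) (rfl : (StdForm.antidiagonal 3).over L = (StdForm.antidiagonal 3).over L)) *
      (v : (quasiSplit (↥(maximalRealSubfield L)) L (IsCMField.complexConj L) 3).Adelic) * g) : ℝ) := by exact_mod_cast borelHeight_pos _
  have hre : ((c₀ : ℂ) + y * I).re = c₀ := by
    simp only [add_re, ofReal_re, mul_re, I_re, mul_zero, ofReal_im, I_im, mul_one, sub_self, add_zero]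
  dsimp only
  simp only [uncurry_apply_pair]
  rw [norm_mul, norm_mul, Complex.norm_cpow_eq_rpow_re_of_pos hHpos, hre, norm_flatSectionU, ofReal_re]
  ring

/-- **THE SWAP**: `∫_{N(𝔸)} ((2π)⁻¹∫_ℝ H(w₀vg)^{c₀+iy}·mellin f(−(c₀+iy)) dy)·ψ(w₀vg) dν(v) = (2π)⁻¹∫_ℝ mellin f(−(c₀+iy))·(∫_{N(𝔸)} f_{c₀+iy}^ψ(w₀vg) dν(v)) dy` (`c₀ > 2`; ★ `flatSectionU ψ w = ψ·H^w`)
— Mathlib `integral_integral_swap` on §1's `L¹(ν ⊗ dy)` integrand (`ν` σ-finite: `N(𝔸)` locally compact second countable, ★ `K2E1HeisenbergHaarU3`). [cite: MoeglinWaldspurger1995, II.1.5, II.1.7] -/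
theorem integral_orbital_mellin_inside_eq_mellin_mul_intertwined_cm_three [MeasurableSpace (AdeleRing (𝓞 L) L)] [BorelSpace (AdeleRing (𝓞 L) L)]
    (ν : Measure ↥(adelicUnipotent (↥(maximalRealSubfield L)) L (IsCMField.complexConj L) 3)) [ν.IsHaarMeasure]
    {f : ℝ → ℂ} (hf : ContDiff ℝ 2 f) (hfs : HasCompactSupport f) (hf0 : tsupport f ⊆ Ioi 0)
    {ψ : (quasiSplit (↥(maximalRealSubfield L)) L (IsCMField.complexConj L) 3).Adelic → ℂ} (hψc : Continuous ψ) {M : ℝ} (hψM : ∀ x, ‖ψ x‖ ≤ M) {c₀ : ℝ} (hc₀ : 2 < c₀)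
    (g : (quasiSplit (↥(maximalRealSubfield L)) L (IsCMField.complexConj L) 3).Adelic) :
    ∫ v : ↥(adelicUnipotent (↥(maximalRealSubfield L)) L (IsCMField.complexConj L) 3),
        ((((2 * π)⁻¹ : ℝ) : ℂ) * ∫ y : ℝ, ((borelHeight ((quasiSplit (↥(maximalRealSubfield L)) L (IsCMField.complexConj L) 3).toAdelic (weylLongU ((IsCMField.complexConj L : L ≃ₐ[↥(maximalRealSubfield L)] L) : L →+* L) (rfl : (StdForm.antidiagonal 3).over L = (StdForm.antidiagonal 3).over L)) *
          (v : (quasiSplit (↥(maximalRealSubfield L)) L (IsCMField.complexConj L) 3).Adelic) * g) : ℝ) : ℂ) ^ ((c₀ : ℂ) + y * I) * mellin f (-((c₀ : ℂ) + y * I))) *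
        ψ ((quasiSplit (↥(maximalRealSubfield L)) L (IsCMField.complexConj L) 3).toAdelic (weylLongU ((IsCMField.complexConj L : L ≃ₐ[↥(maximalRealSubfield L)] L) : L →+* L) (rfl : (StdForm.antidiagonal 3).over L = (StdForm.antidiagonal 3).over L)) *
          (v : (quasiSplit (↥(maximalRealSubfield L)) L (IsCMField.complexConj L) 3).Adelic) * g) ∂ν =
      (((2 * π)⁻¹ : ℝ) : ℂ) * ∫ y : ℝ, mellin f (-((c₀ : ℂ) + y * I)) *
        ∫ v : ↥(adelicUnipotent (↥(maximalRealSubfield L)) L (IsCMField.complexConj L) 3),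
          flatSectionU ψ ((c₀ : ℂ) + y * I) ((quasiSplit (↥(maximalRealSubfield L)) L (IsCMField.complexConj L) 3).toAdelic (weylLongU ((IsCMField.complexConj L : L ≃ₐ[↥(maximalRealSubfield L)] L) : L →+* L) (rfl : (StdForm.antidiagonal 3).over L = (StdForm.antidiagonal 3).over L)) *
            (v : (quasiSplit (↥(maximalRealSubfield L)) L (IsCMField.complexConj L) 3).Adelic) * g) ∂ν := by
  obtain ⟨hN1, hN2⟩ := locallyCompactSpace_and_secondCountableTopology_adelicUnipotent (F := ↥(maximalRealSubfield L)) (E := L) (c := IsCMField.complexConj L) (N := 3)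
  haveI := hN1
  haveI := hN2
  haveI : SigmaFinite ν := inferInstance
  have hInt := integrable_orbitalMellinIntegrand_prod_cm_three L ν hf hfs hf0 hψc hψM hc₀ g
  -- (i) pull `ψ(w₀vg)` inside the `y`-integral and `κ` outside the `v`-integral
  have h1 : ∀ v : ↥(adelicUnipotent (↥(maximalRealSubfield L)) L (IsCMField.complexConj L) 3),
      ((((2 * π)⁻¹ : ℝ) : ℂ) * ∫ y : ℝ, ((borelHeight ((quasiSplit (↥(maximalRealSubfield L)) L (IsCMField.complexConj L) 3).toAdelic (weylLongU ((IsCMField.complexConj L : L ≃ₐ[↥(maximalRealSubfield L)] L) : L →+* L) (rfl : (StdForm.antidiagonal 3).over L = (StdForm.antidiagonal 3).over L)) *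
          (v : (quasiSplit (↥(maximalRealSubfield L)) L (IsCMField.complexConj L) 3).Adelic) * g) : ℝ) : ℂ) ^ ((c₀ : ℂ) + y * I) * mellin f (-((c₀ : ℂ) + y * I))) *
        ψ ((quasiSplit (↥(maximalRealSubfield L)) L (IsCMField.complexConj L) 3).toAdelic (weylLongU ((IsCMField.complexConj L : L ≃ₐ[↥(maximalRealSubfield L)] L) : L →+* L) (rfl : (StdForm.antidiagonal 3).over L = (StdForm.antidiagonal 3).over L)) *
          (v : (quasiSplit (↥(maximalRealSubfield L)) L (IsCMField.complexConj L) 3).Adelic) * g) =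
      (((2 * π)⁻¹ : ℝ) : ℂ) * ∫ y : ℝ, ((borelHeight ((quasiSplit (↥(maximalRealSubfield L)) L (IsCMField.complexConj L) 3).toAdelic (weylLongU ((IsCMField.complexConj L : L ≃ₐ[↥(maximalRealSubfield L)] L) : L →+* L) (rfl : (StdForm.antidiagonal 3).over L = (StdForm.antidiagonal 3).over L)) *
          (v : (quasiSplit (↥(maximalRealSubfield L)) L (IsCMField.complexConj L) 3).Adelic) * g) : ℝ) : ℂ) ^ ((c₀ : ℂ) + y * I) * mellin f (-((c₀ : ℂ) + y * I)) *
        ψ ((quasiSplit (↥(maximalRealSubfield L)) L (IsCMField.complexConj L) 3).toAdelic (weylLongU ((IsCMField.complexConj L : L ≃ₐ[↥(maximalRealSubfield L)] L) : L →+* L) (rfl : (StdForm.antidiagonal 3).over L = (StdForm.antidiagonal 3).over L)) *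
          (v : (quasiSplit (↥(maximalRealSubfield L)) L (IsCMField.complexConj L) 3).Adelic) * g) := fun v => by
    rw [mul_assoc, ← integral_mul_const]
  simp_rw [h1]
  rw [integral_const_mul, integral_integral_swap hInt]
  -- (ii) the inner `v`-integral: `Φ(v,y) = mellin f(−w)·f_w^ψ(w₀vg)`
  congr 1
  refine integral_congr_ae (Eventually.of_forall fun y => ?_)
  dsimp only
  rw [← integral_const_mul]
  refine integral_congr_ae (Eventually.of_forall fun v => ?_)
  dsimp only
  simp only [flatSectionU_apply]
  ring

/-! ## §2 HEAD: the intertwined part of the constant term as a Mellin line integral of intertwining integrals -/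

/-- **hFub-b — `CT θ_{f,ψ}(g) − f(Hg)ψ(g) = (ν𝓕)⁻¹•((2π)⁻¹∫_ℝ mellin f(−(c₀+iy))·(∫_{N(𝔸)} f_{c₀+iy}^ψ(w₀vg) dν(v)) dy)`** in the Godement range `c₀ > 2`.  Data as in ★ C2 ∕ ★ hFub-a: a Haar
measure `ν` on `N(𝔸_{L⁺})`, a fundamental domain `𝓕` of `N(L⁺)` with compact closure, `f ∈ C²_c((0,∞))`, `ψ` continuous bounded, left-`N(𝔸)`- and left-`B(L⁺)`-invariant, any `g`
(and any Borel structure on `𝔸_L`, carried by ★ K2E1-p14's `L¹` lemma).  ★ hFub-a p865351 (Mellin inversion inside the orbital integral) then §1 (Fubini).  The inner integral is the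
intertwining integral of the flat section `f_w^ψ` — ★ `K2E1ChiIntertwinedSectionU3.flatSectionU_intertwinedCoeff_three_eq` rewrites it as `(M(w₀,w)ψ)(g)·H(g)^{2−w}` for piece (c).
[cite: MoeglinWaldspurger1995, II.1.5, II.1.7] [cite: Titchmarsh1948, Thm 71–72] -/
theorem borelConstantTerm_sub_eq_mellin_intertwined_cm_three [MeasurableSpace (AdeleRing (𝓞 L) L)] [BorelSpace (AdeleRing (𝓞 L) L)]
    (ν : Measure ↥(adelicUnipotent (↥(maximalRealSubfield L)) L (IsCMField.complexConj L) 3)) [ν.IsHaarMeasure]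
    {𝓕 : Set ↥(adelicUnipotent (↥(maximalRealSubfield L)) L (IsCMField.complexConj L) 3)}
    (h𝓕N : IsFundamentalDomain ↥(rationalUnipotent (↥(maximalRealSubfield L)) L (IsCMField.complexConj L) 3) 𝓕 ν) (h𝓕c : IsCompact (closure 𝓕))
    {f : ℝ → ℂ} (hf : ContDiff ℝ 2 f) (hfs : HasCompactSupport f) (hf0 : tsupport f ⊆ Ioi 0)
    {ψ : (quasiSplit (↥(maximalRealSubfield L)) L (IsCMField.complexConj L) 3).Adelic → ℂ} (hψc : Continuous ψ) {M : ℝ} (hψM : ∀ x, ‖ψ x‖ ≤ M)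
    (hψN : ∀ (u : ↥(adelicUnipotent (↥(maximalRealSubfield L)) L (IsCMField.complexConj L) 3)) (x : (quasiSplit (↥(maximalRealSubfield L)) L (IsCMField.complexConj L) 3).Adelic),
      ψ ((u : (quasiSplit (↥(maximalRealSubfield L)) L (IsCMField.complexConj L) 3).Adelic) * x) = ψ x)
    (hψB : ∀ b ∈ borelU ((IsCMField.complexConj L : L ≃ₐ[↥(maximalRealSubfield L)] L) : L →+* L) ((StdForm.antidiagonal 3).over L), ∀ x : (quasiSplit (↥(maximalRealSubfield L)) L (IsCMField.complexConj L) 3).Adelic,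
      ψ ((quasiSplit (↥(maximalRealSubfield L)) L (IsCMField.complexConj L) 3).toAdelic b * x) = ψ x)
    {c₀ : ℝ} (hc₀ : 2 < c₀) (g : (quasiSplit (↥(maximalRealSubfield L)) L (IsCMField.complexConj L) 3).Adelic) :
    borelConstantTerm ν 𝓕 (eisensteinSeriesU (fun x : (quasiSplit (↥(maximalRealSubfield L)) L (IsCMField.complexConj L) 3).Adelic => f (borelHeight x : ℝ) * ψ x)) g -
        f (borelHeight g : ℝ) * ψ g =
      ((ν 𝓕).toReal⁻¹ : ℝ) • ((((2 * π)⁻¹ : ℝ) : ℂ) * ∫ y : ℝ, mellin f (-((c₀ : ℂ) + y * I)) *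
        ∫ v : ↥(adelicUnipotent (↥(maximalRealSubfield L)) L (IsCMField.complexConj L) 3),
          flatSectionU ψ ((c₀ : ℂ) + y * I) ((quasiSplit (↥(maximalRealSubfield L)) L (IsCMField.complexConj L) 3).toAdelic (weylLongU ((IsCMField.complexConj L : L ≃ₐ[↥(maximalRealSubfield L)] L) : L →+* L) (rfl : (StdForm.antidiagonal 3).over L = (StdForm.antidiagonal 3).over L)) *
            (v : (quasiSplit (↥(maximalRealSubfield L)) L (IsCMField.complexConj L) 3).Adelic) * g) ∂ν) := by
  rw [borelConstantTerm_sub_eq_orbital_mellin_inside_cm_three L ν h𝓕N h𝓕c hf hfs hf0 hψc hψM hψN hψB c₀ g,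
    integral_orbital_mellin_inside_eq_mellin_mul_intertwined_cm_three L ν hf hfs hf0 hψc hψM hc₀ g]

end Summit.HodgeConjecture.HodgeConjecture.Cruxes.H413.K2E1ChiOrbitalIntegralFubiniCMThree

end
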